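import Literature.MathematicalPhysics.QuantumFieldTheory.Dimock2011to13.RandomWalkExpansion
import Literature.MathematicalPhysics.QuantumFieldTheory.Dimock2011to13.QED3BlockPotentialSums
import HarnessLib

/-!
# Dimock, *Quantum electrodynamics on the 3-torus II*, §3.2 THEOREM 1, proof Part III (p.24 L59 – p.25 L12):
# THE RANDOM WALK ESTIMATE WITH SINGULAR KERNELS — from the block bounds (137) ∕ (143) on the links of a path to the
# path bound (134) `|S_{k,Λ,ω}(A,x,y)| ≤ O(1)(O(1)M₀^{−1})^{|ω|}d′(x,y)^{−2}e^{−O(1)d(x,y)}` and the summed bound (135) —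
# PROVED in the single-scale member (Remark 3: `Λ` = the full tori, `d_Λ = d`), with (154) taken as the block
# convolution hypothesis (DISCHARGED on `ℤ³` by the tree's LEMMA 1 (130)) and (155) = the tree's chain-of-exponentials
# bound BY NAME

statement-level skeleton of published theorems with citation tags; proofs where landed; nothing here is a claim about the Yang–Mills mass gap

(Writer seat p11 = literature-prover-lit-balaban-p11-g21-0; YM LIT SWEEP item (c), Lean lane — zero weight for the
YM-INPRINT tokens of row C13.)

**Citation header (reproduction of PUBLISHED work).** J. Dimock, *Quantum electrodynamics on the 3-torus II. The RG
flow*, arXiv:math-ph/0407063v1 (2004) [Dimock2004QED3TorusII], §3.2 «fermions», pp.22–25 of the held text layer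
`paper:arxiv-math-ph_0407063` (`p.NN Lnn` = PDF page ∕ text-layer line).  The chain bound (155) is attributed by the paper
to T. Bałaban, CMP **95** (1984) 17–40, Lemma 2.1 (= its [7], [Balaban1984Propagators]); here it is the tree's
`RandomWalkExpansion.sum_exp_chain_le` (Dimock's own later rendering, [Dimock2013] §2.4), used BY NAME.

**What the paper prints (verbatim, text layer).**
* p.22 L2–11, (132): *"The random walk expansion for `S_{k,Λ}(A,x,y)` has the form `S_{k,Λ}(A,x,y) = Σ_{ω:x→y}
  S_{k,Λ,ω}(A,x,y)` (132). Here we are summing over paths `ω` each of which is a sequence of adjacent cubes (blocks)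
  `□_0,…,□_n` from `D`. … the adjacency condition is that `□_j, □_{j+1}` should touch, possibly only on corners, and
  including the possibility `□_j = □_{j+1}`. The notation `ω : x → y` means `x ∈ □̃_0`, `y ∈ □̃_n`. We let `|ω| = n` be
  the number of links."*
* p.22 L12–23, THEOREM 1: *"… Let `M₀` be sufficiently large and let `e_k` be sufficiently small. Then `S_{k,Λ}(A,x,y)`
  exists and has the random walk expansion (132). We have the bound for each path `|S_{k,Λ,ω}(A,x,y)| ≤
  O(1)(O(1)M₀^{−1})^{|ω|}d′(x,y)^{−2}exp(−O(1)d_Λ(x,y))` (134) and the bound for the full propagator `|S_{k,Λ}(A,x,y)| ≤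
  O(1)d′(x,y)^{−2}exp(−O(1)d_Λ(x,y))` (135)"*; Remark 3, p.22 L28–30: *"It is possible that `Λ` is a sequence of the full
  tori … In this case `d_Λ(x,y) = d(x,y)` and we have the result (53) for `S_k(A,x,y)`."*
* p.23 L22–32, (142): `S_{k,Λ}(A) = Σ_{n=0}^∞ Σ_{□_0,…,□_n} (h_{□_0}S*_{□_0}(A)h_{□_0})(R_{□_1}(A)S*_{□_1}(A)h_{□_1})⋯
  (R_{□_n}(A)S*_{□_n}(A)h_{□_n}) ≡ Σ_ω S_{k,Λ,ω}(A)`; p.22 L45, (137): `|S*_□(A,x,y)| ≤ O(1)d′(x,y)^{−2}exp(−O(1)d_Λ(x,y))`;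
  p.23 L59–65, (143): *"For `□ ∈ D_i` `|(R_□(A)S*_□(A))(x,y)| ≤ O(L^{k−i}∕M₀)d′(x,y)^{−2}exp(−O(1)d_Λ(x,y))`"*.
* p.24 L59 – p.25 L12, PART III: *"Now we estimate the expansion. Besides the partition (122) we can also partition
  `L^{−k}Λ_0` into smaller blocks `Δ` of size `L^{−(k−i)}` in `δΛ^{(k)}_i`. Then for `ω = (□_0,…,□_n)` `S_{k,Λ,ω}(A,x,y) =
  Σ_{Δ_1,…,Δ_n}∫_{Δ_1}dx_1…∫_{Δ_n}dx_n (h_{□_0}S*_{□_0}(A)h_{□_0})(x,x_1)(R_{□_1}S*_{□_1}(A)h_{□_1})(x_1,x_2)⋯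
  (R_{□_n}S*_{□_n}(A)h_{□_n})(x_n,y)` (152). We can restrict the sum to `Δ_j` intersecting both `□̃_{j−1}` and `□̃_j`. Now
  use the estimates (137), (143) to obtain `|S_{k,Λ,ω}(A,x,y)| ≤ (O(1)M₀)^{−n}Σ_{Δ_1,…,Δ_n}∫_{Δ_1}dx_1…∫_{Δ_n}dx_n
  (d′(x,x_1)^{−2}e^{−O(1)d_Λ(x,x_1)})(L^{k−i_1}d′(x_1,x_2)^{−2}e^{−O(1)d_Λ(x_1,x_2)})⋯(L^{k−i_n}d′(x_n,y)^{−2}e^{−O(1)d_Λ(x_n,y)})`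
  (153). … Now use `d_Λ(x_i,x_{i+1}) ≥ d_Λ(Δ_i,Δ_{i+1}) − 2` where the distance is from the center of the cubes. Then
  repeatedly use the estimate `L^{k−i_j}∫_{Δ_j}d′(x_{j−1},x_j)^{−2}d′(x_j,x_{j+1})^{−2}dx_j ≤ O(d′(x_{j−1},x_{j+1})^{−2})`
  (154) which follow from (130). … We also use the estimate `Σ_{Δ_1,…,Δ_n}e^{−O(1)d_Λ(x,Δ_1)}e^{−O(1)d_Λ(Δ_1,Δ_2)}…
  e^{−O(1)d_Λ(Δ_n,y)} ≤ (O(1))^n exp(−O(1)d_Λ(x,y))` (155). For this see [7], lemma 2.1. These estimates yield the bound on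
  `S_{k,Λ,ω}(A,x,y)`. For the bound on `S_{k,Λ}(A,x,y)` we sum over paths. The factor `(O(1)M₀)^{−n}` is sufficient to
  control the sum if `M₀` is sufficiently large."*

* (v1.1) §3.3 p.30 L1–5, THEOREM 2: *"Let `M₀` be sufficiently large. Then `G_{k,Λ}` exists and has the random walk expansion (194).
  We have `|G_{k,Λ,ω}(x,y)| ≤ O(1)(O(1)M₀^{−1})^{|ω|}d′(x,y)^{−1}exp(−O(1)d_Λ(x,y))`, `|G_{k,Λ}(x,y)| ≤ O(1)d′(x,y)^{−1}exp(−O(1)d_Λ(x,y))`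
  (195)"*; (198) p.30 L17–20 `|G*_□(x,y)| ≤ O(1)d′(x,y)^{−1}exp(−O(1)d_Λ(x,y))`; (201) p.30 L60–67 `|(R^D_□G*_□)(x,y)| ≤
  O(1)M₀^{−1}(L^{2(k−i)}d′(x,y)^{−1} + L^{k−i}d′(x,y)^{−2})exp(−O(1)d_Λ(x,y))`; p.30 L75 – p.31 L9: *"Now we follow the proof of
  theorem 1. The only difference is in the short distance estimates which we modify as follows. Instead of (154) we have by
  (129), (130), (131) `∫_{Δ_j}(L^{2(k−i_j)}d′(x_{j−1},x_j)^{−1} + L^{k−i_j}d′(x_{j−1},x_j)^{−2})(L^{2(k−i_j)}d′(x_j,x_{j+1})^{−1} +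
  L^{k−i_j}d′(x_j,x_{j+1})^{−2})dx_j ≤ O(L^{2(k−i_j)})d′(x_{j−1},x_{j+1})^{−1} + O(L^{k−i_j})d′(x_{j−1},x_{j+1})^{−2}` (202) … In the
  last step since `|i − i_0| ≤ 1` the inequality is `∫_{Δ_1}d′(x,x_1)^{−1}(O(L^{2(k−i)})d′(x_1,y)^{−1} + O(L^{k−i})d′(x_1,y)^{−2})dx_1
  ≤ O(1)d′(x,y)^{−1}` (203). The rest of the proof is as before and gives the result for `G_{k,Λ,ω}` and `G_{k,Λ}`."*

**The member formalized (declared): SINGLE SCALE.** Remark 3's case — `Λ_i` = the full tori, so `d_Λ = d`, every cube of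
`D` is a last-scale `M₀L^{0}`-cube and every small block `Δ` is a unit block (`i_j = k`, all factors `L^{k−i_j} = 1`);
the multi-region geometry (`δΛ_i`, `D_i`, `d_Λ` of (122)–(127)) is NOT formalized.  The sites form a type `X` with
«integrals» `∫dx = Σ_x w` (`w = L^{−3k}`), the unit blocks are the fibres of a label map `blk : X → B` with centres
`ctr : B → X` at distance `≤ r` from their sites, `d ≥ 0` is a symmetric distance with the triangle inequality, and the
singular weight `d′(x,y)^{−2}` is an abstract kernel `P ≥ 0` entering only through (154).  In this member:
* (152) is `pathKernel` ∕ `fullNest_eq_sum_blockNest`: the kernel of the ordered product of the link operators with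
  weighted intermediate integrals (`pathKernel w Ks n`, `Ks 0` = `h_{□_0}S*_{□_0}h_{□_0}`, `Ks j` = `R_{□_j}S*_{□_j}h_{□_j}`,
  values in any real normed algebra — spinor matrices), and the decomposition of the intermediate integrals into blocks
  (`fullNest = Σ_{Δ_1…Δ_n} blockNest`, the restriction to blocks meeting `□̃_{j−1} ∩ □̃_j` being DROPPED — all terms are
  `≥ 0`, so the unrestricted sum is an upper bound);
* (153) is `norm_pathKernel_le`: `‖Ks 0(u,v)‖ ≤ C₀F(u,v)`, `‖Ks (j+1)(u,v)‖ ≤ (C₁∕M₀)F(u,v)` with the profile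
  `F = P·e^{−c·d}` of (137) ∕ (143) give `‖pathKernel‖ ≤ C₀(C₁∕M₀)^n·fullNest F`;
* (154) is the HYPOTHESIS `hconv`: `Σ_{y∈Δ} w·P(u,y)P(y,v) ≤ θ·P(u,v)` for every block — on the `ℤ³` lattice member it
  is the tree's LEMMA 1 (130) at `α = 2` (`hconv_Z3`: `QED3BlockPotentialSums.eq130`, `θ = 2³C(2)·(ηR)` for blocks of
  `≤ R³` sites at spacing `η`, `= 8C(2)` for unit blocks `ηR = 1`);
* «`d(x_i,x_{i+1}) ≥ d(Δ_i,Δ_{i+1}) − 2`» is `exp_link_le` (`e^{−cd(u,v)} ≤ e^{2cr}e^{−cd(ctr Δ_u,ctr Δ_v)}`), and the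
  iteration of (154) along the chain with the exponentials relocated to the centres is `blockNest_le_chain`;
* (155) is `RandomWalkExpansion.sum_exp_chain_le` BY NAME over the block labels (`K` = the one-point block sum
  `sup_Δ Σ_{Δ′}e^{−(c∕2)d(Δ,Δ′)}`, a hypothesis), giving **`sum_blockNest_le`**:
  `Σ_{Δ_1…Δ_n} blockNest ≤ e^{3cr}(θKe^{2cr})^n·P(x,y)·e^{−(c∕2)d(x,y)}`;
* **(134) = `dimock134`**: `‖S_ω(x,y)‖ ≤ C₀e^{3cr}·(C₁θKe^{2cr}∕M₀)^{|ω|}·P(x,y)·e^{−(c∕2)d(x,y)}` — the printed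
  `O(1)(O(1)M₀^{−1})^{|ω|}d′(x,y)^{−2}e^{−O(1)d(x,y)}` with every `O(1)` explicit in `C₀, C₁, θ, K, c, r`;
* **(135) = `dimock135_partialSums`**: if the paths of length `n` from `x` number `≤ ν^{n+1}` (`ν = 3³`: `□_0 ∋ x` and each
  next cube touches the previous one) and each is bounded as in (134) by `C₀(C₂∕M₀)^nΦ`, then for `M₀ ≥ 2νC₂` every partial
  sum of (132) has norm `≤ 2νC₀Φ` — *"the factor `(O(1)M₀)^{−n}` is sufficient to control the sum if `M₀` is sufficiently
  large"*, with «sufficiently large» the number `2νC₂`.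

* (v1.1) **THEOREM 2 (195), the boson member** (§5): the path term of the photon propagator `G_{k,Λ,ω}` has a
  DIFFERENT profile on its first link — (198) `|G*_□| ≤ O(1)d′^{−1}e^{−O(1)d}` for `h_□G*_□h_□` versus (201)
  `|R_□G*_□| ≤ O(1)M₀^{−1}(d′^{−1} + d′^{−2})e^{−O(1)d}` (single scale) for the other links; `blockNest₂` ∕ `fullNest₂` ∕
  `norm_pathKernel_le₂` ∕ `fullNest₂_eq_sum_blockNest₂` ∕ `blockNest₂_le_chain` ∕ `sum_blockNest₂_le` redo §§1–2 with the
  first-link profile `P₀` closed by (203) `Σ_Δ wP₀P ≤ θP₀` and the inner links by (202) `Σ_Δ wPP ≤ θP`, giving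
  **`dimock195`**: `‖G_ω(x,y)‖ ≤ C₀e^{3cr}(C₁θKe^{2cr}∕M₀)^{|ω|}·P₀(x,y)·e^{−(c∕2)d(x,y)}` — the printed
  `|G_{k,Λ,ω}(x,y)| ≤ O(1)(O(1)M₀^{−1})^{|ω|}d′(x,y)^{−1}exp(−O(1)d_Λ(x,y))`; and (§6) **(202) ∕ (203) DISCHARGED on `ℤ³`**
  for `P₀ = d′^{−1}`, `P = d′^{−1} + d′^{−2}` by LEMMA 1 (130) (`α = 1, 2`) and (131) (`hconv_Z3_boson`, `hconv₀_Z3_boson`,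
  common constant `θ′ = 4C(1)(ηR)² + 2√8C(2)(ηR) + 8C(2)(ηR)`).  The derivative members (196) ∕ (204) are NOT formalized
  separately (in the single-scale member (196) for `∂G_{k,Λ,ω}` is `dimock134` itself with `P = d′^{−1} + d′^{−2}` on every
  link and `hconv_Z3_boson`).
* (v1.2) **the path count of (132)** (§7): `walks adj S₀ n` = the sequences `(□_0,…,□_n)` with `□_0 ∈ S₀` and consecutive
  cubes adjacent; **`card_walks_le`**: `#walks ≤ ν^{n+1}` when `#S₀ ≤ ν` and every cube has `≤ ν` adjacent cubes (`ν = 27`);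
  **`dimock135_walks`**: (135) with this count in place of the hypothesis `#(W n) ≤ ν^{n+1}` of `dimock135_partialSums`.

**HONEST SCOPE ∕ what is NOT claimed.** Parts I–II of the proof — the parametrix (138)–(141), LEMMA 2 (136)–(137) (soft
Dirichlet local inverses), the commutator bounds (143)–(151) — and the EXISTENCE half of THEOREM 1 are not touched: the
link kernels `Ks j` and their bounds `C₀F`, `(C₁∕M₀)F` are hypotheses in the printed shape of (137) ∕ (143); the algebraic
skeleton `S = S*(I − R)^{−1} = Σ_ω S_ω` is the tree's `RandomWalkExpansion` (not restated).  The multiscale version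
(`L^{−(k−i)}` blocks in `δΛ_i`, factors `L^{k−i_j}`, the metric `d_Λ`) is NOT formalized (single-scale member only; the
engine is scale-free: `hconv` with `θ = O(L^{k−i}·L^{−(k−i)})` is the printed (154)).  The convergence of the full series
(132) is not asserted — (135) is proved for every partial sum, uniformly.  Gauge covariance and the `A`-dependence
statements of THEOREM 1 are not here.  NOT a statement about the ultraviolet problem in `d = 4`; NOT a claim about any
Bałaban paper ([7] Lemma 2.1 enters only through the tree's D1 rendering).  Unit `lit-balaban-p11-g21`, HOME
`run/shared/lean/pub/lit-balaban/`, 2026-08-22.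

**Version.** v1.1 — APPEND-ONLY to v1.0 (p341041): + §5 (THEOREM 2 (195) boson member) and §6 (its `ℤ³` discharges);
every v1.0 declaration byte-identical.  v1.2 — APPEND-ONLY to v1.1 (p341554): + §7 (the path count `card_walks_le`,
`dimock135_walks`); every v1.1 declaration byte-identical.
-/

noncomputable section

open Finset Real
open Literature.MathematicalPhysics.QuantumFieldTheory.Dimock2011to13.RandomWalkExpansion (chainLen sum_exp_chain_le)

namespace Literature.MathematicalPhysics.QuantumFieldTheory.Dimock2011to13

namespace QED3TorusII

/-! ## §1 (142) ∕ (152)–(153): the path term, its majorant, and the partition into blocks -/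

section PathTerm

variable {X B : Type*}

/-- **The iterated block integrals of (152) ∕ (153) along a FIXED sequence of blocks** `Δ(bs 0), …, Δ(bs (n−1))`:
`blockNest Δ w F n x bs y = ∫_{Δ_1}dx_1⋯∫_{Δ_n}dx_n F(x,x_1)F(x_1,x_2)⋯F(x_n,y)` with `∫_Δ dx = Σ_{x∈Δ} w`
(`w = L^{−3k}`), defined by peeling the first integral. [cite: Dimock2004QED3TorusII, §3.2 proof of Thm 1 Part III (152)–(153) p.24 L59–93] -/
def blockNest (Δ : B → Finset X) (w : ℝ) (F : X → X → ℝ) : (n : ℕ) → X → (Fin n → B) → X → ℝ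
  | 0, x, _, y => F x y
  | n + 1, x, bs, y => ∑ x₁ ∈ Δ (bs 0), w * (F x x₁ * blockNest Δ w F n x₁ (Fin.tail bs) y)

variable [Fintype X]

/-- **The undecomposed intermediate integrals**: `fullNest w F n x y = ∫dx_1⋯∫dx_n F(x,x_1)⋯F(x_n,y)` over ALL sites
(the majorant of the path term before the partition into blocks `Δ`). [cite: Dimock2004QED3TorusII, §3.2 proof of Thm 1 Part III (152) p.24 L59–75] -/
def fullNest (w : ℝ) (F : X → X → ℝ) : (n : ℕ) → X → X → ℝ
  | 0, x, y => F x y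
  | n + 1, x, y => ∑ x₁, w * (F x x₁ * fullNest w F n x₁ y)

variable {E : Type*} [NormedRing E] [NormedAlgebra ℝ E]

/-- **The path term (142) ∕ (152) as a kernel**: for link kernels `Ks 0 = h_{□_0}S*_{□_0}h_{□_0}`, `Ks j = R_{□_j}S*_{□_j}h_{□_j}`
(`j ≥ 1`; values in a real normed algebra, e.g. spinor matrices), `pathKernel w Ks n x y =
∫dx_1⋯∫dx_n Ks 0(x,x_1)·Ks 1(x_1,x_2)⋯Ks n(x_n,y)` — the kernel of the ordered operator product with the weighted sums
`∫dx = Σ_x w` as composition. [cite: Dimock2004QED3TorusII, §3.2 proof of Thm 1 (142) p.23 L22–32 and (152) p.24 L59–75] -/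
def pathKernel (w : ℝ) : (K : ℕ → X → X → E) → (n : ℕ) → X → X → E
  | K, 0, x, y => K 0 x y
  | K, n + 1, x, y => ∑ x₁, w • (K 0 x x₁ * pathKernel w (fun j => K (j + 1)) n x₁ y)

/-- `fullNest` of a nonnegative kernel is nonnegative (`w ≥ 0`). [cite: Dimock2004QED3TorusII, §3.2 proof of Thm 1 Part III (153) p.24 L76–93] -/
theorem fullNest_nonneg {w : ℝ} (hw : 0 ≤ w) {F : X → X → ℝ} (hF : ∀ u v, 0 ≤ F u v) :
    ∀ (n : ℕ) (x y : X), 0 ≤ fullNest w F n x y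
  | 0, x, y => hF x y
  | n + 1, x, y => sum_nonneg fun x₁ _ => mul_nonneg hw (mul_nonneg (hF x x₁) (fullNest_nonneg hw hF n x₁ y))

/-- **(153): the path term against its majorant.**  If `‖Ks 0(u,v)‖ ≤ a₀F(u,v)` ((137) with `|h| ≤ 1`: `a₀ = O(1)`) and
`‖Ks (j+1)(u,v)‖ ≤ aF(u,v)` ((143): `a = O(1)M₀^{−1}`), `F ≥ 0`, then `‖pathKernel w Ks n x y‖ ≤ a₀a^n·fullNest w F n x y`
— *"Now use the estimates (137), (143) to obtain (153)"*. [cite: Dimock2004QED3TorusII, §3.2 proof of Thm 1 Part III (153) p.24 L76–93] -/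
theorem norm_pathKernel_le {w : ℝ} (hw : 0 ≤ w) {F : X → X → ℝ} (hF : ∀ u v, 0 ≤ F u v) {a : ℝ}
    (ha : 0 ≤ a) :
    ∀ (n : ℕ) (K : ℕ → X → X → E) (a₀ : ℝ), (∀ u v, ‖K 0 u v‖ ≤ a₀ * F u v) →
      (∀ j u v, ‖K (j + 1) u v‖ ≤ a * F u v) → ∀ (x y : X),
      ‖pathKernel w K n x y‖ ≤ a₀ * a ^ n * fullNest w F n x y
  | 0, K, a₀, h0, _, x, y => by simpa [pathKernel, fullNest] using h0 x y
  | n + 1, K, a₀, h0, hS, x, y => by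
      have ih := norm_pathKernel_le hw hF ha n (fun j => K (j + 1)) a (hS 0) (fun j => hS (j + 1))
      show ‖∑ x₁, w • (K 0 x x₁ * pathKernel w (fun j => K (j + 1)) n x₁ y)‖
        ≤ a₀ * a ^ (n + 1) * ∑ x₁, w * (F x x₁ * fullNest w F n x₁ y)
      calc ‖∑ x₁, w • (K 0 x x₁ * pathKernel w (fun j => K (j + 1)) n x₁ y)‖
          ≤ ∑ x₁, ‖w • (K 0 x x₁ * pathKernel w (fun j => K (j + 1)) n x₁ y)‖ := norm_sum_le _ _
        _ ≤ ∑ x₁, w * ((a₀ * F x x₁) * (a * a ^ n * fullNest w F n x₁ y)) := by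
            refine sum_le_sum fun x₁ _ => ?_
            rw [norm_smul, Real.norm_of_nonneg hw]
            refine mul_le_mul_of_nonneg_left ?_ hw
            exact (norm_mul_le _ _).trans
              (mul_le_mul (h0 x x₁) (ih x₁ y) (norm_nonneg _)
                ((norm_nonneg _).trans (h0 x x₁)))
        _ = a₀ * a ^ (n + 1) * ∑ x₁, w * (F x x₁ * fullNest w F n x₁ y) := by
            rw [mul_sum]; exact sum_congr rfl fun x₁ _ => by ring

variable [Fintype B] [DecidableEq B]

/-- **(152): partition of the intermediate integrals into blocks.**  With the blocks the fibres `Δ_b = {u : blk u = b}`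
of a label map, `∫dx_1⋯∫dx_n F⋯F = Σ_{Δ_1,…,Δ_n}∫_{Δ_1}dx_1⋯∫_{Δ_n}dx_n F⋯F`, i.e. `fullNest = Σ_{bs} blockNest … bs`
(Fubini and `Σ_x = Σ_ΔΣ_{x∈Δ}`, by induction on `n`). [cite: Dimock2004QED3TorusII, §3.2 proof of Thm 1 Part III (152) p.24 L59–75] -/
theorem fullNest_eq_sum_blockNest (blk : X → B) (w : ℝ) (F : X → X → ℝ) :
    ∀ (n : ℕ) (x y : X), fullNest w F n x y
      = ∑ bs : Fin n → B, blockNest (fun b => univ.filter fun u => blk u = b) w F n x bs y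
  | 0, x, y => by
      rw [Fintype.sum_unique]
      rfl
  | n + 1, x, y => by
      set Δ : B → Finset X := fun b => univ.filter fun u => blk u = b with hΔ
      have ih : ∀ x₁, fullNest w F n x₁ y = ∑ bs : Fin n → B, blockNest Δ w F n x₁ bs y :=
        fun x₁ => fullNest_eq_sum_blockNest blk w F n x₁ y
      calc fullNest w F (n + 1) x y
          = ∑ x₁, w * (F x x₁ * fullNest w F n x₁ y) := rfl
        _ = ∑ b, ∑ x₁ ∈ Δ b, w * (F x x₁ * fullNest w F n x₁ y) :=
            (sum_fiberwise univ blk _).symm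
        _ = ∑ b, ∑ x₁ ∈ Δ b, ∑ bs : Fin n → B, w * (F x x₁ * blockNest Δ w F n x₁ bs y) := by
            refine sum_congr rfl fun b _ => sum_congr rfl fun x₁ _ => ?_
            rw [ih x₁, mul_sum, mul_sum]
        _ = ∑ b, ∑ bs : Fin n → B, ∑ x₁ ∈ Δ b, w * (F x x₁ * blockNest Δ w F n x₁ bs y) := by
            refine sum_congr rfl fun b _ => ?_
            rw [sum_comm]
        _ = ∑ p : B × (Fin n → B), ∑ x₁ ∈ Δ p.1, w * (F x x₁ * blockNest Δ w F n x₁ p.2 y) := by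
            rw [Fintype.sum_prod_type]
        _ = ∑ bs : Fin (n + 1) → B, blockNest Δ w F (n + 1) x bs y := by
            refine Fintype.sum_equiv (Fin.consEquiv fun _ => B) _ _ fun p => ?_
            simp [Fin.consEquiv, blockNest]

end PathTerm

/-! ## §2 (153)–(155) ⟹ (134): iterating the block convolution bound along the chain -/

section Walk

variable {X B : Type*}
variable {Δ : B → Finset X} {w : ℝ}

/-- no intermediate integral: `blockNest … 0 x bs y = F(x,y)`. [cite: Dimock2004QED3TorusII, §3.2 proof of Thm 1 Part III (152) p.24 L59–75] -/
theorem blockNest_zero (F : X → X → ℝ) (x y : X) (bs : Fin 0 → B) :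
    blockNest Δ w F 0 x bs y = F x y := rfl

/-- peeling the first block integral: `blockNest (n+1) x bs y = ∫_{Δ(bs 0)}dx_1 F(x,x_1)·blockNest n x_1 (tail bs) y`.
[cite: Dimock2004QED3TorusII, §3.2 proof of Thm 1 Part III (152) p.24 L59–75] -/
theorem blockNest_succ (F : X → X → ℝ) (n : ℕ) (x y : X) (bs : Fin (n + 1) → B) :
    blockNest Δ w F (n + 1) x bs y
      = ∑ x₁ ∈ Δ (bs 0), w * (F x x₁ * blockNest Δ w F n x₁ (Fin.tail bs) y) := rfl

/-- `blockNest` of a nonnegative kernel is nonnegative (`w ≥ 0`). [cite: Dimock2004QED3TorusII, §3.2 proof of Thm 1 Part III (153) p.24 L76–93] -/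
theorem blockNest_nonneg (hw : 0 ≤ w) {F : X → X → ℝ} (hF : ∀ u v, 0 ≤ F u v) :
    ∀ (n : ℕ) (x : X) (bs : Fin n → B) (y : X), 0 ≤ blockNest Δ w F n x bs y
  | 0, x, bs, y => hF x y
  | n + 1, x, bs, y => by
      rw [blockNest_succ]
      exact sum_nonneg fun x₁ _ => mul_nonneg hw (mul_nonneg (hF x x₁) (blockNest_nonneg hw hF n _ _ _))

/-- `blockNest` is monotone in the (nonnegative) kernel. [cite: Dimock2004QED3TorusII, §3.2 proof of Thm 1 Part III (153) p.24 L76–93] -/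
theorem blockNest_mono (hw : 0 ≤ w) {F G : X → X → ℝ} (hF : ∀ u v, 0 ≤ F u v) (hFG : ∀ u v, F u v ≤ G u v) :
    ∀ (n : ℕ) (x : X) (bs : Fin n → B) (y : X), blockNest Δ w F n x bs y ≤ blockNest Δ w G n x bs y
  | 0, x, bs, y => hFG x y
  | n + 1, x, bs, y => by
      rw [blockNest_succ, blockNest_succ]
      refine sum_le_sum fun x₁ _ => mul_le_mul_of_nonneg_left ?_ hw
      exact mul_le_mul (hFG x x₁) (blockNest_mono hw hF hFG n _ _ _)
        (blockNest_nonneg hw hF n _ _ _) ((hF x x₁).trans (hFG x x₁))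

/-- kernel: a factor constant on the block comes out of the block integral. [folklore] -/
private theorem sum_mul_const_factor (b : B) (A : X → ℝ) (Q : ℝ) :
    ∑ x₁ ∈ Δ b, w * (A x₁ * Q) = Q * ∑ x₁ ∈ Δ b, w * A x₁ := by
  rw [mul_sum]; exact sum_congr rfl fun x₁ _ => by ring

variable {d P : X → X → ℝ} {blk : X → B} {ctr : B → X} {c r θ : ℝ}

/-- **«`d(x_i,x_{i+1}) ≥ d(Δ_i,Δ_{i+1}) − 2` where the distance is from the center of the cubes»**: if every site is
within `r` of the centre of its block, `e^{−c·d(u,v)} ≤ e^{2cr}·e^{−c·d(ctr Δ_u, ctr Δ_v)}` (`c ≥ 0`; triangle inequality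
and symmetry of `d`). [cite: Dimock2004QED3TorusII, §3.2 proof of Thm 1 Part III p.24 L94–95] -/
theorem exp_link_le (hsymm : ∀ u v, d u v = d v u)
    (htri : ∀ u v t, d u t ≤ d u v + d v t) (hrad : ∀ u, d u (ctr (blk u)) ≤ r) (hc : 0 ≤ c) (u v : X) :
    Real.exp (-(c * d u v)) ≤ Real.exp (2 * c * r) * Real.exp (-c * d (ctr (blk u)) (ctr (blk v))) := by
  rw [← Real.exp_add]
  apply Real.exp_le_exp.2
  have h1 := htri (ctr (blk u)) u (ctr (blk v))
  have h2 := htri u v (ctr (blk v))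
  have h3 := hrad u
  have h4 := hrad v
  rw [hsymm] at h3
  nlinarith

/-- **Iterating (154) along the chain, exponentials relocated to the block centres.**  Blocks `Δ` with labels
(`blk u = b` on `Δ b`) and centres within `r`; the singular weight `P ≥ 0` with the block convolution bound (154)
`Σ_{y∈Δ}w·P(u,y)P(y,v) ≤ θP(u,v)` for EVERY block; `d ≥ 0` symmetric with the triangle inequality; `c ≥ 0`.  Then for the
profile `F = P·e^{−cd}` and every block sequence `bs`:
`blockNest Δ w F n x bs y ≤ (θe^{2cr})^n·e^{2cr}·P(x,y)·exp(−c·[d(Δ_x,Δ_{bs 0}) + d(Δ_{bs 0},Δ_{bs 1}) + ⋯ + d(Δ_{bs(n−1)},Δ_y)])`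
(the bracket is `RandomWalkExpansion.chainLen` of the centre distance; `Δ_x` = the block of `x`) — *"Then repeatedly use
the estimate (154)"*, innermost integral first. [cite: Dimock2004QED3TorusII, §3.2 proof of Thm 1 Part III (153)–(154) p.24 L76–99] -/
theorem blockNest_le_chain (hw : 0 ≤ w) (hθ : 0 ≤ θ) (hc : 0 ≤ c) (hP0 : ∀ u v, 0 ≤ P u v)
    (hconv : ∀ (b : B) (u v : X), ∑ y ∈ Δ b, w * (P u y * P y v) ≤ θ * P u v)
    (hsymm : ∀ u v, d u v = d v u) (htri : ∀ u v t, d u t ≤ d u v + d v t)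
    (hrad : ∀ u, d u (ctr (blk u)) ≤ r) (hblk : ∀ b, ∀ u ∈ Δ b, blk u = b) :
    ∀ (n : ℕ) (x : X) (bs : Fin n → B) (y : X),
      blockNest Δ w (fun u v => P u v * Real.exp (-(c * d u v))) n x bs y
        ≤ (θ * Real.exp (2 * c * r)) ^ n * Real.exp (2 * c * r) * P x y *
            Real.exp (-c * chainLen (fun b b' => d (ctr b) (ctr b')) n (blk x) bs (blk y))
  | 0, x, bs, y => by
      rw [blockNest_zero, pow_zero, one_mul]
      have h := exp_link_le hsymm htri hrad hc x y
      calc P x y * Real.exp (-(c * d x y))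
          ≤ P x y * (Real.exp (2 * c * r) * Real.exp (-c * d (ctr (blk x)) (ctr (blk y)))) :=
            mul_le_mul_of_nonneg_left h (hP0 x y)
        _ = _ := by simp only [chainLen]; ring
  | n + 1, x, bs, y => by
      rw [blockNest_succ]
      set A := θ * Real.exp (2 * c * r) with hA
      set dB : B → B → ℝ := fun b b' => d (ctr b) (ctr b') with hdB
      -- the constant that comes out of the x₁-sum
      set Q := Real.exp (2 * c * r) * (A ^ n * Real.exp (2 * c * r)) *
          Real.exp (-c * chainLen dB (n + 1) (blk x) bs (blk y)) with hQ
      have hQ0 : 0 ≤ Q := by positivity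
      have hstep : ∀ x₁ ∈ Δ (bs 0),
          w * ((P x x₁ * Real.exp (-(c * d x x₁))) *
            blockNest Δ w (fun u v => P u v * Real.exp (-(c * d u v))) n x₁ (Fin.tail bs) y)
            ≤ w * ((P x x₁ * P x₁ y) * Q) := by
        intro x₁ hx₁
        have hb : blk x₁ = bs 0 := hblk (bs 0) x₁ hx₁
        have ih := blockNest_le_chain hw hθ hc hP0 hconv hsymm htri hrad hblk n x₁ (Fin.tail bs) y
        have hlink := exp_link_le hsymm htri hrad hc x x₁
        rw [hb] at ih hlink
        -- chainLen (n+1) (blk x) bs (blk y) = dB (blk x) (bs 0) + chainLen n (bs 0) (tail bs) (blk y)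
        have hcl : chainLen dB (n + 1) (blk x) bs (blk y)
            = dB (blk x) (bs 0) + chainLen dB n (bs 0) (Fin.tail bs) (blk y) := rfl
        have hexp : Real.exp (-(c * d x x₁)) *
            Real.exp (-c * chainLen dB n (bs 0) (Fin.tail bs) (blk y))
            ≤ Real.exp (2 * c * r) * Real.exp (-c * chainLen dB (n + 1) (blk x) bs (blk y)) := by
          rw [hcl, show -c * (dB (blk x) (bs 0) + chainLen dB n (bs 0) (Fin.tail bs) (blk y))
              = -c * d (ctr (blk x)) (ctr (bs 0)) + -c * chainLen dB n (bs 0) (Fin.tail bs) (blk y) by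
              rw [hdB]; ring, Real.exp_add, ← mul_assoc]
          exact mul_le_mul_of_nonneg_right hlink (Real.exp_pos _).le
        refine mul_le_mul_of_nonneg_left ?_ hw
        have hnest0 := blockNest_nonneg (Δ := Δ) hw
          (F := fun u v => P u v * Real.exp (-(c * d u v))) (fun u v => mul_nonneg (hP0 u v) (Real.exp_pos _).le)
          n x₁ (Fin.tail bs) y
        calc (P x x₁ * Real.exp (-(c * d x x₁))) *
              blockNest Δ w (fun u v => P u v * Real.exp (-(c * d u v))) n x₁ (Fin.tail bs) y
            ≤ (P x x₁ * Real.exp (-(c * d x x₁))) *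
              (A ^ n * Real.exp (2 * c * r) * P x₁ y *
                Real.exp (-c * chainLen dB n (bs 0) (Fin.tail bs) (blk y))) :=
              mul_le_mul_of_nonneg_left ih (mul_nonneg (hP0 _ _) (Real.exp_pos _).le)
          _ = (P x x₁ * P x₁ y) * (A ^ n * Real.exp (2 * c * r)) *
              (Real.exp (-(c * d x x₁)) * Real.exp (-c * chainLen dB n (bs 0) (Fin.tail bs) (blk y))) := by
              ring
          _ ≤ (P x x₁ * P x₁ y) * (A ^ n * Real.exp (2 * c * r)) *
              (Real.exp (2 * c * r) * Real.exp (-c * chainLen dB (n + 1) (blk x) bs (blk y))) :=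
              mul_le_mul_of_nonneg_left hexp (by have := hP0 x x₁; have := hP0 x₁ y; positivity)
          _ = (P x x₁ * P x₁ y) * Q := by rw [hQ]; ring
      calc ∑ x₁ ∈ Δ (bs 0), w * ((P x x₁ * Real.exp (-(c * d x x₁))) *
            blockNest Δ w (fun u v => P u v * Real.exp (-(c * d u v))) n x₁ (Fin.tail bs) y)
          ≤ ∑ x₁ ∈ Δ (bs 0), w * ((P x x₁ * P x₁ y) * Q) := sum_le_sum hstep
        _ = Q * ∑ x₁ ∈ Δ (bs 0), w * (P x x₁ * P x₁ y) := sum_mul_const_factor _ _ _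
        _ ≤ Q * (θ * P x y) := mul_le_mul_of_nonneg_left (hconv (bs 0) x y) hQ0
        _ = (θ * Real.exp (2 * c * r)) ^ (n + 1) * Real.exp (2 * c * r) * P x y *
            Real.exp (-c * chainLen dB (n + 1) (blk x) bs (blk y)) := by
            rw [hQ, hA]; ring

variable [Fintype B]

/-- **(153) + (154) + (155) ⟹ the profile of (134).**  Under the hypotheses of `blockNest_le_chain` and the one-point
block sum `Σ_{Δ′} e^{−(c∕2)d(ctr Δ, ctr Δ′)} ≤ K` for every block (finitely many blocks):
`Σ_{Δ_1,…,Δ_n} blockNest Δ w F n x (Δ_1,…,Δ_n) y ≤ e^{3cr}·(θKe^{2cr})^n·P(x,y)·e^{−(c∕2)d(x,y)}` — (155) *"`Σ_{Δ_1,…,Δ_n}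
e^{−O(1)d(x,Δ_1)}⋯e^{−O(1)d(Δ_n,y)} ≤ (O(1))^n exp(−O(1)d(x,y))`. For this see [7], lemma 2.1"* is the tree's
`RandomWalkExpansion.sum_exp_chain_le` over the block labels (half the decay pays the sums, half survives), and the
end blocks cost `e^{cr}`. [cite: Dimock2004QED3TorusII, §3.2 proof of Thm 1 Part III (153)–(155) p.24 L76 – p.25 L10] -/
theorem sum_blockNest_le (hw : 0 ≤ w) (hθ : 0 ≤ θ) (hc : 0 ≤ c) (hP0 : ∀ u v, 0 ≤ P u v)
    (hconv : ∀ (b : B) (u v : X), ∑ y ∈ Δ b, w * (P u y * P y v) ≤ θ * P u v)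
    (hd0 : ∀ u v, 0 ≤ d u v) (hsymm : ∀ u v, d u v = d v u) (htri : ∀ u v t, d u t ≤ d u v + d v t)
    (hrad : ∀ u, d u (ctr (blk u)) ≤ r) (hblk : ∀ b, ∀ u ∈ Δ b, blk u = b) {K : ℝ}
    (hK : ∀ b : B, ∑ b', Real.exp (-(c / 2) * d (ctr b) (ctr b')) ≤ K) (n : ℕ) (x y : X) :
    ∑ bs : Fin n → B, blockNest Δ w (fun u v => P u v * Real.exp (-(c * d u v))) n x bs y
      ≤ Real.exp (3 * c * r) * (θ * K * Real.exp (2 * c * r)) ^ n * P x y *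
          Real.exp (-(c / 2) * d x y) := by
  set dB : B → B → ℝ := fun b b' => d (ctr b) (ctr b') with hdB
  have hdB0 : ∀ a b, 0 ≤ dB a b := fun a b => hd0 _ _
  have hdBtri : ∀ a b e, dB a e ≤ dB a b + dB b e := fun a b e => htri _ _ _
  have hchain := sum_exp_chain_le (d := dB) hc hdB0 hdBtri hK n (blk x) (blk y)
  have hend : Real.exp (-(c / 2) * dB (blk x) (blk y))
      ≤ Real.exp (c * r) * Real.exp (-(c / 2) * d x y) := by
    rw [← Real.exp_add]
    apply Real.exp_le_exp.2
    have h1 := htri x (ctr (blk x)) y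
    have h2 := htri (ctr (blk x)) (ctr (blk y)) y
    have h3 := hrad x
    have h4 := hrad y
    rw [hsymm] at h4
    have : dB (blk x) (blk y) = d (ctr (blk x)) (ctr (blk y)) := rfl
    nlinarith
  have hPxy := hP0 x y
  have h3 : Real.exp (3 * c * r) = Real.exp (2 * c * r) * Real.exp (c * r) := by
    rw [← Real.exp_add]; ring_nf
  calc ∑ bs : Fin n → B, blockNest Δ w (fun u v => P u v * Real.exp (-(c * d u v))) n x bs y
      ≤ ∑ bs : Fin n → B, (θ * Real.exp (2 * c * r)) ^ n * Real.exp (2 * c * r) * P x y *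
            Real.exp (-c * chainLen dB n (blk x) bs (blk y)) :=
        sum_le_sum fun bs _ => blockNest_le_chain hw hθ hc hP0 hconv hsymm htri hrad hblk n x bs y
    _ = (θ * Real.exp (2 * c * r)) ^ n * Real.exp (2 * c * r) * P x y *
          ∑ bs : Fin n → B, Real.exp (-c * chainLen dB n (blk x) bs (blk y)) := by rw [mul_sum]
    _ ≤ (θ * Real.exp (2 * c * r)) ^ n * Real.exp (2 * c * r) * P x y *
          (K ^ n * Real.exp (-(c / 2) * dB (blk x) (blk y))) :=
        mul_le_mul_of_nonneg_left hchain (by positivity)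
    _ ≤ (θ * Real.exp (2 * c * r)) ^ n * Real.exp (2 * c * r) * P x y *
          (K ^ n * (Real.exp (c * r) * Real.exp (-(c / 2) * d x y))) := by
        refine mul_le_mul_of_nonneg_left (mul_le_mul_of_nonneg_left hend ?_) (by positivity)
        have hK0 : 0 ≤ K := (hK (blk x)).trans' (sum_nonneg fun b _ => (Real.exp_pos _).le)
        positivity
    _ = Real.exp (3 * c * r) * (θ * K * Real.exp (2 * c * r)) ^ n * P x y *
          Real.exp (-(c / 2) * d x y) := by
        rw [h3, mul_pow, mul_pow, mul_pow]; ring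

variable [Fintype X] [DecidableEq B] {E : Type*} [NormedRing E] [NormedAlgebra ℝ E]

/-- **THEOREM 1 (134), single-scale member: the bound for each path.**  Sites `X` (finite), unit blocks = the fibres of
`blk : X → B` with centres `ctr` within `r`, weights `w ≥ 0`, singular weight `P ≥ 0` with (154) on every block
(constant `θ`; on `ℤ³` = `hconv_Z3`), distance `d ≥ 0` symmetric with the triangle inequality, one-point block sum `≤ K`,
link kernels with (137) `‖Ks 0(u,v)‖ ≤ C₀·P(u,v)e^{−cd(u,v)}` and (143) `‖Ks (j+1)(u,v)‖ ≤ (C₁∕M₀)·P(u,v)e^{−cd(u,v)}`.  Then the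
path term of length `n = |ω|` obeys
`‖S_ω(x,y)‖ = ‖pathKernel w Ks n x y‖ ≤ C₀e^{3cr}·(C₁θKe^{2cr}∕M₀)^n·P(x,y)·e^{−(c∕2)d(x,y)}`
— the printed `|S_{k,Λ,ω}(A,x,y)| ≤ O(1)(O(1)M₀^{−1})^{|ω|}d′(x,y)^{−2}exp(−O(1)d_Λ(x,y))` with `d_Λ = d` (Remark 3) and every
`O(1)` explicit. [cite: Dimock2004QED3TorusII, §3.2 Thm 1 (134) p.22 L12–19, proof Part III p.24 L59 – p.25 L10] -/
theorem dimock134 (hw : 0 ≤ w) (hθ : 0 ≤ θ) (hc : 0 ≤ c) (hP0 : ∀ u v, 0 ≤ P u v)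
    (hconv : ∀ (b : B) (u v : X),
      ∑ y ∈ univ.filter (fun u => blk u = b), w * (P u y * P y v) ≤ θ * P u v)
    (hd0 : ∀ u v, 0 ≤ d u v) (hsymm : ∀ u v, d u v = d v u) (htri : ∀ u v t, d u t ≤ d u v + d v t)
    (hrad : ∀ u, d u (ctr (blk u)) ≤ r) {K : ℝ}
    (hK : ∀ b : B, ∑ b', Real.exp (-(c / 2) * d (ctr b) (ctr b')) ≤ K)
    {C₀ C₁ M₀ : ℝ} (hC₀ : 0 ≤ C₀) (hC₁ : 0 ≤ C₁) (hM₀ : 0 < M₀) (Ks : ℕ → X → X → E)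
    (hK0 : ∀ u v, ‖Ks 0 u v‖ ≤ C₀ * (P u v * Real.exp (-(c * d u v))))
    (hKS : ∀ j u v, ‖Ks (j + 1) u v‖ ≤ C₁ / M₀ * (P u v * Real.exp (-(c * d u v)))) (n : ℕ) (x y : X) :
    ‖pathKernel w Ks n x y‖ ≤ C₀ * Real.exp (3 * c * r) * (C₁ * θ * K * Real.exp (2 * c * r) / M₀) ^ n
        * P x y * Real.exp (-(c / 2) * d x y) := by
  have hF0 : ∀ u v, 0 ≤ P u v * Real.exp (-(c * d u v)) := fun u v => mul_nonneg (hP0 u v) (Real.exp_pos _).le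
  have h1 := norm_pathKernel_le hw hF0 (by positivity : 0 ≤ C₁ / M₀) n Ks C₀ hK0 hKS x y
  rw [fullNest_eq_sum_blockNest blk] at h1
  have hblk : ∀ b, ∀ u ∈ univ.filter (fun u => blk u = b), blk u = b :=
    fun b u hu => (mem_filter.1 hu).2
  have h2 := sum_blockNest_le (Δ := fun b => univ.filter fun u => blk u = b) hw hθ hc hP0 hconv hd0 hsymm
    htri hrad hblk hK n x y
  refine h1.trans ?_
  calc C₀ * (C₁ / M₀) ^ n *
        ∑ bs : Fin n → B, blockNest (fun b => univ.filter fun u => blk u = b) w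
          (fun u v => P u v * Real.exp (-(c * d u v))) n x bs y
      ≤ C₀ * (C₁ / M₀) ^ n * (Real.exp (3 * c * r) * (θ * K * Real.exp (2 * c * r)) ^ n * P x y *
          Real.exp (-(c / 2) * d x y)) := mul_le_mul_of_nonneg_left h2 (by positivity)
    _ = _ := by
        have e : (C₁ * θ * K * Real.exp (2 * c * r) / M₀) ^ n
            = (C₁ / M₀) ^ n * (θ * K * Real.exp (2 * c * r)) ^ n := by
          rw [← mul_pow]; congr 1; ring
        rw [e]; ring

end Walk

/-! ## §3 (135): the sum over paths -/

section Paths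

variable {Ω : Type*}

/-- **THEOREM 1 (135): the sum over paths.**  If the paths of length `n` (from the given `x`) form finite sets `W n` with
`#(W n) ≤ ν^{n+1}` (`ν = 3³ = 27`: `□_0` is one of the cubes whose triple contains `x`, and *"`□_j, □_{j+1}` should touch,
possibly only on corners, and including the possibility `□_j = □_{j+1}`"*), and each path term satisfies (134) in the form
`‖S_ω‖ ≤ C₀(C₂∕M₀)^nΦ` (`Φ` = the profile at `(x,y)`), then for `M₀ ≥ 2νC₂` EVERY partial sum of the random walk expansion
(132) obeys `‖Σ_{n<N}Σ_{ω∈W n}S_ω‖ ≤ 2νC₀Φ` — *"For the bound on `S_{k,Λ}(A,x,y)` we sum over paths. The factor `(O(1)M₀)^{−n}`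
is sufficient to control the sum if `M₀` is sufficiently large"* (geometric series of ratio `νC₂∕M₀ ≤ ½`).
[cite: Dimock2004QED3TorusII, §3.2 Thm 1 (135) p.22 L12–21 and (132) p.22 L2–11, proof p.25 L10–12] -/
theorem dimock135_partialSums {E : Type*} [SeminormedAddCommGroup E] (W : ℕ → Finset Ω) (S : Ω → E)
    {ν C₀ C₂ M₀ Φ : ℝ} (hν : 0 ≤ ν) (hC₀ : 0 ≤ C₀) (hC₂ : 0 ≤ C₂) (hΦ : 0 ≤ Φ) (hM₀ : 0 < M₀)
    (hlarge : 2 * (ν * C₂) ≤ M₀) (hcard : ∀ n, ((W n).card : ℝ) ≤ ν ^ (n + 1))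
    (hS : ∀ n, ∀ ω ∈ W n, ‖S ω‖ ≤ C₀ * (C₂ / M₀) ^ n * Φ) (N : ℕ) :
    ‖∑ n ∈ range N, ∑ ω ∈ W n, S ω‖ ≤ 2 * ν * C₀ * Φ := by
  have hq0 : 0 ≤ ν * C₂ / M₀ := by positivity
  have hq : ν * C₂ / M₀ ≤ 1 / 2 := by
    rw [div_le_iff₀ hM₀]; linarith
  calc ‖∑ n ∈ range N, ∑ ω ∈ W n, S ω‖
      ≤ ∑ n ∈ range N, ‖∑ ω ∈ W n, S ω‖ := norm_sum_le _ _
    _ ≤ ∑ n ∈ range N, ∑ ω ∈ W n, ‖S ω‖ := sum_le_sum fun n _ => norm_sum_le _ _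
    _ ≤ ∑ n ∈ range N, ∑ ω ∈ W n, C₀ * (C₂ / M₀) ^ n * Φ :=
        sum_le_sum fun n _ => sum_le_sum fun ω hω => hS n ω hω
    _ = ∑ n ∈ range N, ((W n).card : ℝ) * (C₀ * (C₂ / M₀) ^ n * Φ) := by
        refine sum_congr rfl fun n _ => ?_; rw [sum_const, nsmul_eq_mul]
    _ ≤ ∑ n ∈ range N, ν ^ (n + 1) * (C₀ * (C₂ / M₀) ^ n * Φ) :=
        sum_le_sum fun n _ => mul_le_mul_of_nonneg_right (hcard n) (by positivity)
    _ = ν * C₀ * Φ * ∑ n ∈ range N, (ν * C₂ / M₀) ^ n := by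
        rw [mul_sum]; refine sum_congr rfl fun n _ => ?_
        rw [pow_succ, mul_div_assoc, mul_pow]; ring
    _ ≤ ν * C₀ * Φ * ∑ n ∈ range N, (1 / 2) ^ n := by
        refine mul_le_mul_of_nonneg_left (sum_le_sum fun n _ => ?_) (by positivity)
        exact pow_le_pow_left₀ hq0 hq n
    _ ≤ ν * C₀ * Φ * 2 := mul_le_mul_of_nonneg_left (sum_geometric_two_le N) (by positivity)
    _ = 2 * ν * C₀ * Φ := by ring

end Paths

/-! ## §4 (154) on the `ℤ³` lattice: discharged by LEMMA 1 (130) -/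

section Z3

/-- **(154) «which follow from (130)» — the `ℤ³` lattice member DISCHARGED.**  For sites of `ℤ³` at spacing `η > 0`, any
block `U` of at most `R³` sites (`R ≥ 1`) and `d′ = η·max(1,|·|∞)` of (128):
`Σ_{y∈U} η³·d′(u,y)^{−2}d′(y,v)^{−2} ≤ 2³C(2)·(ηR)·d′(u,v)^{−2}` — the tree's LEMMA 1 (130) (`QED3BlockPotentialSums.eq130`) at
`α = 2`; for unit blocks (`R = L^k` sites per side at `η = L^{−k}`, `ηR = 1`) the constant is `8C(2)`, `C(2) = 289`; this is
the hypothesis `hconv` of `dimock134` with `w = η³`, `P = d′^{−2}`, `θ = 2³C(2)(ηR)`.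
[cite: Dimock2004QED3TorusII, §3.2 proof of Thm 1 Part III (154) p.24 L95 – p.25 L1 and §3.1 Lemma 1 (130) p.21 L40–42] -/
theorem hconv_Z3 {η : ℝ} (hη : 0 < η) {R : ℕ} (hR : 1 ≤ R) (U : Finset (Fin 3 → ℤ))
    (hcard : U.card ≤ R ^ 3) (u v : Fin 3 → ℤ) :
    ∑ y ∈ U, η ^ 3 * (dprime η u y ^ (-(2 : ℝ)) * dprime η y v ^ (-(2 : ℝ)))
      ≤ (2 ^ ((2 : ℝ) + 1) * blockConst 2 * (η * R) ^ ((3 : ℝ) - 2)) * dprime η u v ^ (-(2 : ℝ)) := by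
  have h := eq130 (α := 2) (by norm_num) (by norm_num) hη U hR hcard u v
  unfold blockIntegral at h
  simpa only [mul_assoc] using h

end Z3

/-! ## §5 (v1.1) THEOREM 2 (195): the boson member — a different profile on the first link -/

section TwoProfile

variable {X B : Type*}

/-- **The block integrals of the boson path term** (proof of THEOREM 2, p.30 L38 – p.31 L12): first link with the
profile `F₀` of `h_□G*_□h_□` ((198): `d′^{−1}e^{−O(1)d}`), the remaining links with the profile `F` of `R_□G*_□h_□`
((201): `(d′^{−1} + d′^{−2})e^{−O(1)d}` in the single-scale member):
`blockNest₂ Δ w F₀ F (n+1) x bs y = ∫_{Δ(bs 0)}dx_1 F₀(x,x_1)·blockNest Δ w F n x_1 (tail bs) y`, `blockNest₂ … 0 x bs y = F₀(x,y)`.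
[cite: Dimock2004QED3TorusII, §3.3 proof of Thm 2 (199)–(203) p.30 L38 – p.31 L12] -/
def blockNest₂ (Δ : B → Finset X) (w : ℝ) (F₀ F : X → X → ℝ) : (n : ℕ) → X → (Fin n → B) → X → ℝ
  | 0, x, _, y => F₀ x y
  | n + 1, x, bs, y => ∑ x₁ ∈ Δ (bs 0), w * (F₀ x x₁ * blockNest Δ w F n x₁ (Fin.tail bs) y)

variable [Fintype X]

/-- **The undecomposed boson majorant**: `fullNest₂ w F₀ F (n+1) x y = ∫dx_1 F₀(x,x_1)·fullNest w F n x_1 y`,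
`fullNest₂ … 0 x y = F₀(x,y)`. [cite: Dimock2004QED3TorusII, §3.3 proof of Thm 2 (199) p.30 L38–45] -/
def fullNest₂ (w : ℝ) (F₀ F : X → X → ℝ) : (n : ℕ) → X → X → ℝ
  | 0, x, y => F₀ x y
  | n + 1, x, y => ∑ x₁, w * (F₀ x x₁ * fullNest w F n x₁ y)

variable {E : Type*} [NormedRing E] [NormedAlgebra ℝ E]

/-- **The boson analogue of (153)**: `‖Ks 0(u,v)‖ ≤ a₀F₀(u,v)` ((198)) and `‖Ks (j+1)(u,v)‖ ≤ aF(u,v)` ((201)),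
`F₀, F ≥ 0`, give `‖pathKernel w Ks n x y‖ ≤ a₀aⁿ·fullNest₂ w F₀ F n x y`.
[cite: Dimock2004QED3TorusII, §3.3 proof of Thm 2 (199)–(201) p.30 L38–72] -/
theorem norm_pathKernel_le₂ {w : ℝ} (hw : 0 ≤ w) {F₀ F : X → X → ℝ} (hF : ∀ u v, 0 ≤ F u v) {a₀ a : ℝ}
    (ha : 0 ≤ a) (Ks : ℕ → X → X → E) (h0 : ∀ u v, ‖Ks 0 u v‖ ≤ a₀ * F₀ u v)
    (hS : ∀ j u v, ‖Ks (j + 1) u v‖ ≤ a * F u v) :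
    ∀ (n : ℕ) (x y : X), ‖pathKernel w Ks n x y‖ ≤ a₀ * a ^ n * fullNest₂ w F₀ F n x y
  | 0, x, y => by simpa [pathKernel, fullNest₂] using h0 x y
  | n + 1, x, y => by
      have ih := norm_pathKernel_le hw hF ha n (fun j => Ks (j + 1)) a (hS 0) (fun j => hS (j + 1))
      show ‖∑ x₁, w • (Ks 0 x x₁ * pathKernel w (fun j => Ks (j + 1)) n x₁ y)‖
        ≤ a₀ * a ^ (n + 1) * ∑ x₁, w * (F₀ x x₁ * fullNest w F n x₁ y)
      calc ‖∑ x₁, w • (Ks 0 x x₁ * pathKernel w (fun j => Ks (j + 1)) n x₁ y)‖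
          ≤ ∑ x₁, ‖w • (Ks 0 x x₁ * pathKernel w (fun j => Ks (j + 1)) n x₁ y)‖ := norm_sum_le _ _
        _ ≤ ∑ x₁, w * ((a₀ * F₀ x x₁) * (a * a ^ n * fullNest w F n x₁ y)) := by
            refine sum_le_sum fun x₁ _ => ?_
            rw [norm_smul, Real.norm_of_nonneg hw]
            refine mul_le_mul_of_nonneg_left ?_ hw
            exact (norm_mul_le _ _).trans
              (mul_le_mul (h0 x x₁) (ih x₁ y) (norm_nonneg _) ((norm_nonneg _).trans (h0 x x₁)))
        _ = a₀ * a ^ (n + 1) * ∑ x₁, w * (F₀ x x₁ * fullNest w F n x₁ y) := by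
            rw [mul_sum]; exact sum_congr rfl fun x₁ _ => by ring

variable [Fintype B] [DecidableEq B]

/-- **(152) for the boson chain**: `fullNest₂ = Σ_{Δ_1,…,Δ_n} blockNest₂` over the fibre blocks.
[cite: Dimock2004QED3TorusII, §3.2 proof of Thm 1 Part III (152) p.24 L59–75 and §3.3 proof of Thm 2 p.30 L75 («Now we follow the proof of theorem 1»)] -/
theorem fullNest₂_eq_sum_blockNest₂ (blk : X → B) (w : ℝ) (F₀ F : X → X → ℝ) :
    ∀ (n : ℕ) (x y : X), fullNest₂ w F₀ F n x y
      = ∑ bs : Fin n → B, blockNest₂ (fun b => univ.filter fun u => blk u = b) w F₀ F n x bs y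
  | 0, x, y => by
      rw [Fintype.sum_unique]
      rfl
  | n + 1, x, y => by
      set Δ : B → Finset X := fun b => univ.filter fun u => blk u = b with hΔ
      have ih : ∀ x₁, fullNest w F n x₁ y = ∑ bs : Fin n → B, blockNest Δ w F n x₁ bs y :=
        fun x₁ => fullNest_eq_sum_blockNest blk w F n x₁ y
      calc fullNest₂ w F₀ F (n + 1) x y
          = ∑ x₁, w * (F₀ x x₁ * fullNest w F n x₁ y) := rfl
        _ = ∑ b, ∑ x₁ ∈ Δ b, w * (F₀ x x₁ * fullNest w F n x₁ y) :=
            (sum_fiberwise univ blk _).symm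
        _ = ∑ b, ∑ x₁ ∈ Δ b, ∑ bs : Fin n → B, w * (F₀ x x₁ * blockNest Δ w F n x₁ bs y) := by
            refine sum_congr rfl fun b _ => sum_congr rfl fun x₁ _ => ?_
            rw [ih x₁, mul_sum, mul_sum]
        _ = ∑ b, ∑ bs : Fin n → B, ∑ x₁ ∈ Δ b, w * (F₀ x x₁ * blockNest Δ w F n x₁ bs y) := by
            refine sum_congr rfl fun b _ => ?_
            rw [sum_comm]
        _ = ∑ p : B × (Fin n → B), ∑ x₁ ∈ Δ p.1, w * (F₀ x x₁ * blockNest Δ w F n x₁ p.2 y) := by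
            rw [Fintype.sum_prod_type]
        _ = ∑ bs : Fin (n + 1) → B, blockNest₂ Δ w F₀ F (n + 1) x bs y := by
            refine Fintype.sum_equiv (Fin.consEquiv fun _ => B) _ _ fun p => ?_
            simp [Fin.consEquiv, blockNest₂]

end TwoProfile

section TwoProfileWalk

variable {X B : Type*} {Δ : B → Finset X} {w : ℝ}
variable {d P₀ P : X → X → ℝ} {blk : X → B} {ctr : B → X} {c r θ₀ θ : ℝ}

/-- **Iterating (202) and closing with (203).**  As in `blockNest_le_chain`, with the inner links of profile
`F = P·e^{−cd}` ((202): `Σ_{y∈Δ}wP(u,y)P(y,v) ≤ θP(u,v)`) and the first link of profile `F₀ = P₀·e^{−cd}` closed by (203):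
`Σ_{y∈Δ}wP₀(u,y)P(y,v) ≤ θP₀(u,v)` (one constant `θ` for both):
`blockNest₂ Δ w F₀ F n x bs y ≤ (θe^{2cr})^n·e^{2cr}·P₀(x,y)·exp(−c·chainLen)` along the block centres — the profile of the
FIRST link survives at the ends (*"In the last step … the inequality is (203)"*).
[cite: Dimock2004QED3TorusII, §3.3 proof of Thm 2 (202)–(203) p.30 L75 – p.31 L9] -/
theorem blockNest₂_le_chain (hw : 0 ≤ w) (hθ : 0 ≤ θ) (hc : 0 ≤ c) (hP0 : ∀ u v, 0 ≤ P u v)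
    (hP₀0 : ∀ u v, 0 ≤ P₀ u v)
    (hconv : ∀ (b : B) (u v : X), ∑ y ∈ Δ b, w * (P u y * P y v) ≤ θ * P u v)
    (hconv₀ : ∀ (b : B) (u v : X), ∑ y ∈ Δ b, w * (P₀ u y * P y v) ≤ θ * P₀ u v)
    (hsymm : ∀ u v, d u v = d v u) (htri : ∀ u v t, d u t ≤ d u v + d v t)
    (hrad : ∀ u, d u (ctr (blk u)) ≤ r) (hblk : ∀ b, ∀ u ∈ Δ b, blk u = b) :
    ∀ (n : ℕ) (x : X) (bs : Fin n → B) (y : X),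
      blockNest₂ Δ w (fun u v => P₀ u v * Real.exp (-(c * d u v)))
          (fun u v => P u v * Real.exp (-(c * d u v))) n x bs y
        ≤ (θ * Real.exp (2 * c * r)) ^ n * Real.exp (2 * c * r) * P₀ x y *
            Real.exp (-c * chainLen (fun b b' => d (ctr b) (ctr b')) n (blk x) bs (blk y))
  | 0, x, bs, y => by
      have h := exp_link_le hsymm htri hrad hc x y
      show P₀ x y * Real.exp (-(c * d x y)) ≤ _
      calc P₀ x y * Real.exp (-(c * d x y))
          ≤ P₀ x y * (Real.exp (2 * c * r) * Real.exp (-c * d (ctr (blk x)) (ctr (blk y)))) :=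
            mul_le_mul_of_nonneg_left h (hP₀0 x y)
        _ = _ := by simp only [chainLen]; ring
  | n + 1, x, bs, y => by
      set A := θ * Real.exp (2 * c * r) with hA
      set dB : B → B → ℝ := fun b b' => d (ctr b) (ctr b') with hdB
      set Q := Real.exp (2 * c * r) * (A ^ n * Real.exp (2 * c * r)) *
          Real.exp (-c * chainLen dB (n + 1) (blk x) bs (blk y)) with hQ
      have hQ0 : 0 ≤ Q := by positivity
      have hstep : ∀ x₁ ∈ Δ (bs 0),
          w * ((P₀ x x₁ * Real.exp (-(c * d x x₁))) *
            blockNest Δ w (fun u v => P u v * Real.exp (-(c * d u v))) n x₁ (Fin.tail bs) y)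
            ≤ w * ((P₀ x x₁ * P x₁ y) * Q) := by
        intro x₁ hx₁
        have hb : blk x₁ = bs 0 := hblk (bs 0) x₁ hx₁
        have ih := blockNest_le_chain hw hθ hc hP0 hconv hsymm htri hrad hblk n x₁ (Fin.tail bs) y
        have hlink := exp_link_le hsymm htri hrad hc x x₁
        rw [hb] at ih hlink
        have hcl : chainLen dB (n + 1) (blk x) bs (blk y)
            = dB (blk x) (bs 0) + chainLen dB n (bs 0) (Fin.tail bs) (blk y) := rfl
        have hexp : Real.exp (-(c * d x x₁)) *
            Real.exp (-c * chainLen dB n (bs 0) (Fin.tail bs) (blk y))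
            ≤ Real.exp (2 * c * r) * Real.exp (-c * chainLen dB (n + 1) (blk x) bs (blk y)) := by
          rw [hcl, show -c * (dB (blk x) (bs 0) + chainLen dB n (bs 0) (Fin.tail bs) (blk y))
              = -c * d (ctr (blk x)) (ctr (bs 0)) + -c * chainLen dB n (bs 0) (Fin.tail bs) (blk y) by
              rw [hdB]; ring, Real.exp_add, ← mul_assoc]
          exact mul_le_mul_of_nonneg_right hlink (Real.exp_pos _).le
        refine mul_le_mul_of_nonneg_left ?_ hw
        calc (P₀ x x₁ * Real.exp (-(c * d x x₁))) *
              blockNest Δ w (fun u v => P u v * Real.exp (-(c * d u v))) n x₁ (Fin.tail bs) y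
            ≤ (P₀ x x₁ * Real.exp (-(c * d x x₁))) *
              (A ^ n * Real.exp (2 * c * r) * P x₁ y *
                Real.exp (-c * chainLen dB n (bs 0) (Fin.tail bs) (blk y))) :=
              mul_le_mul_of_nonneg_left ih (mul_nonneg (hP₀0 _ _) (Real.exp_pos _).le)
          _ = (P₀ x x₁ * P x₁ y) * (A ^ n * Real.exp (2 * c * r)) *
              (Real.exp (-(c * d x x₁)) * Real.exp (-c * chainLen dB n (bs 0) (Fin.tail bs) (blk y))) := by
              ring
          _ ≤ (P₀ x x₁ * P x₁ y) * (A ^ n * Real.exp (2 * c * r)) *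
              (Real.exp (2 * c * r) * Real.exp (-c * chainLen dB (n + 1) (blk x) bs (blk y))) :=
              mul_le_mul_of_nonneg_left hexp (by have := hP₀0 x x₁; have := hP0 x₁ y; positivity)
          _ = (P₀ x x₁ * P x₁ y) * Q := by rw [hQ]; ring
      show ∑ x₁ ∈ Δ (bs 0), w * ((P₀ x x₁ * Real.exp (-(c * d x x₁))) *
            blockNest Δ w (fun u v => P u v * Real.exp (-(c * d u v))) n x₁ (Fin.tail bs) y) ≤ _
      calc ∑ x₁ ∈ Δ (bs 0), w * ((P₀ x x₁ * Real.exp (-(c * d x x₁))) *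
            blockNest Δ w (fun u v => P u v * Real.exp (-(c * d u v))) n x₁ (Fin.tail bs) y)
          ≤ ∑ x₁ ∈ Δ (bs 0), w * ((P₀ x x₁ * P x₁ y) * Q) := sum_le_sum hstep
        _ = Q * ∑ x₁ ∈ Δ (bs 0), w * (P₀ x x₁ * P x₁ y) := sum_mul_const_factor _ _ _
        _ ≤ Q * (θ * P₀ x y) := mul_le_mul_of_nonneg_left (hconv₀ (bs 0) x y) hQ0
        _ = (θ * Real.exp (2 * c * r)) ^ (n + 1) * Real.exp (2 * c * r) * P₀ x y *
            Real.exp (-c * chainLen dB (n + 1) (blk x) bs (blk y)) := by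
            rw [hQ, hA]; ring

variable [Fintype B]

/-- **THEOREM 2's chain summed over the blocks** ((202)–(203) + (155)): under the hypotheses of `blockNest₂_le_chain` and
the one-point block sum `≤ K`: `Σ_{Δ_1,…,Δ_n} blockNest₂ ≤ e^{3cr}·(θKe^{2cr})^n·P₀(x,y)·e^{−(c∕2)d(x,y)}`.
[cite: Dimock2004QED3TorusII, §3.3 proof of Thm 2 p.30 L75 – p.31 L9 («The rest of the proof is as before»)] -/
theorem sum_blockNest₂_le (hw : 0 ≤ w) (hθ : 0 ≤ θ) (hc : 0 ≤ c) (hP0 : ∀ u v, 0 ≤ P u v)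
    (hP₀0 : ∀ u v, 0 ≤ P₀ u v)
    (hconv : ∀ (b : B) (u v : X), ∑ y ∈ Δ b, w * (P u y * P y v) ≤ θ * P u v)
    (hconv₀ : ∀ (b : B) (u v : X), ∑ y ∈ Δ b, w * (P₀ u y * P y v) ≤ θ * P₀ u v)
    (hd0 : ∀ u v, 0 ≤ d u v) (hsymm : ∀ u v, d u v = d v u) (htri : ∀ u v t, d u t ≤ d u v + d v t)
    (hrad : ∀ u, d u (ctr (blk u)) ≤ r) (hblk : ∀ b, ∀ u ∈ Δ b, blk u = b) {K : ℝ}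
    (hK : ∀ b : B, ∑ b', Real.exp (-(c / 2) * d (ctr b) (ctr b')) ≤ K) (n : ℕ) (x y : X) :
    ∑ bs : Fin n → B, blockNest₂ Δ w (fun u v => P₀ u v * Real.exp (-(c * d u v)))
        (fun u v => P u v * Real.exp (-(c * d u v))) n x bs y
      ≤ Real.exp (3 * c * r) * (θ * K * Real.exp (2 * c * r)) ^ n * P₀ x y *
          Real.exp (-(c / 2) * d x y) := by
  set dB : B → B → ℝ := fun b b' => d (ctr b) (ctr b') with hdB
  have hdB0 : ∀ a b, 0 ≤ dB a b := fun a b => hd0 _ _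
  have hdBtri : ∀ a b e, dB a e ≤ dB a b + dB b e := fun a b e => htri _ _ _
  have hchain := sum_exp_chain_le (d := dB) hc hdB0 hdBtri hK n (blk x) (blk y)
  have hend : Real.exp (-(c / 2) * dB (blk x) (blk y))
      ≤ Real.exp (c * r) * Real.exp (-(c / 2) * d x y) := by
    rw [← Real.exp_add]
    apply Real.exp_le_exp.2
    have h1 := htri x (ctr (blk x)) y
    have h2 := htri (ctr (blk x)) (ctr (blk y)) y
    have h3 := hrad x
    have h4 := hrad y
    rw [hsymm] at h4
    have : dB (blk x) (blk y) = d (ctr (blk x)) (ctr (blk y)) := rfl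
    nlinarith
  have hPxy := hP₀0 x y
  have h3 : Real.exp (3 * c * r) = Real.exp (2 * c * r) * Real.exp (c * r) := by
    rw [← Real.exp_add]; ring_nf
  calc ∑ bs : Fin n → B, blockNest₂ Δ w (fun u v => P₀ u v * Real.exp (-(c * d u v)))
          (fun u v => P u v * Real.exp (-(c * d u v))) n x bs y
      ≤ ∑ bs : Fin n → B, (θ * Real.exp (2 * c * r)) ^ n * Real.exp (2 * c * r) * P₀ x y *
            Real.exp (-c * chainLen dB n (blk x) bs (blk y)) :=
        sum_le_sum fun bs _ =>
          blockNest₂_le_chain hw hθ hc hP0 hP₀0 hconv hconv₀ hsymm htri hrad hblk n x bs y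
    _ = (θ * Real.exp (2 * c * r)) ^ n * Real.exp (2 * c * r) * P₀ x y *
          ∑ bs : Fin n → B, Real.exp (-c * chainLen dB n (blk x) bs (blk y)) := by rw [mul_sum]
    _ ≤ (θ * Real.exp (2 * c * r)) ^ n * Real.exp (2 * c * r) * P₀ x y *
          (K ^ n * Real.exp (-(c / 2) * dB (blk x) (blk y))) :=
        mul_le_mul_of_nonneg_left hchain (by positivity)
    _ ≤ (θ * Real.exp (2 * c * r)) ^ n * Real.exp (2 * c * r) * P₀ x y *
          (K ^ n * (Real.exp (c * r) * Real.exp (-(c / 2) * d x y))) := by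
        refine mul_le_mul_of_nonneg_left (mul_le_mul_of_nonneg_left hend ?_) (by positivity)
        have hK0 : 0 ≤ K := (hK (blk x)).trans' (sum_nonneg fun b _ => (Real.exp_pos _).le)
        positivity
    _ = Real.exp (3 * c * r) * (θ * K * Real.exp (2 * c * r)) ^ n * P₀ x y *
          Real.exp (-(c / 2) * d x y) := by
        rw [h3, mul_pow, mul_pow, mul_pow]; ring

variable [Fintype X] [DecidableEq B] {E : Type*} [NormedRing E] [NormedAlgebra ℝ E]

/-- **THEOREM 2 (195), single-scale member: the bound for each boson path.**  As `dimock134`, with the first link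
bounded by the profile of (198) (`‖Ks 0(u,v)‖ ≤ C₀·P₀(u,v)e^{−cd(u,v)}`, `P₀ = d′^{−1}`) and the other links by the profile
of (201) (`‖Ks (j+1)(u,v)‖ ≤ (C₁∕M₀)·P(u,v)e^{−cd(u,v)}`, `P = d′^{−1} + d′^{−2}`), and the block convolution bounds (202)
`Σ_Δ wPP ≤ θP`, (203) `Σ_Δ wP₀P ≤ θP₀` (on `ℤ³`: `hconv_Z3_boson`, `hconv₀_Z3_boson`):
`‖G_ω(x,y)‖ = ‖pathKernel w Ks n x y‖ ≤ C₀e^{3cr}·(C₁θKe^{2cr}∕M₀)^n·P₀(x,y)·e^{−(c∕2)d(x,y)}` — the printed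
`|G_{k,Λ,ω}(x,y)| ≤ O(1)(O(1)M₀^{−1})^{|ω|}d′(x,y)^{−1}exp(−O(1)d_Λ(x,y))` with `d_Λ = d`; the sum over paths is
`dimock135_partialSums` verbatim. [cite: Dimock2004QED3TorusII, §3.3 Thm 2 (195) p.30 L1–5, proof p.30 L38 – p.31 L12] -/
theorem dimock195 (hw : 0 ≤ w) (hθ : 0 ≤ θ) (hc : 0 ≤ c) (hP0 : ∀ u v, 0 ≤ P u v) (hP₀0 : ∀ u v, 0 ≤ P₀ u v)
    (hconv : ∀ (b : B) (u v : X),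
      ∑ y ∈ univ.filter (fun u => blk u = b), w * (P u y * P y v) ≤ θ * P u v)
    (hconv₀ : ∀ (b : B) (u v : X),
      ∑ y ∈ univ.filter (fun u => blk u = b), w * (P₀ u y * P y v) ≤ θ * P₀ u v)
    (hd0 : ∀ u v, 0 ≤ d u v) (hsymm : ∀ u v, d u v = d v u) (htri : ∀ u v t, d u t ≤ d u v + d v t)
    (hrad : ∀ u, d u (ctr (blk u)) ≤ r) {K : ℝ}
    (hK : ∀ b : B, ∑ b', Real.exp (-(c / 2) * d (ctr b) (ctr b')) ≤ K)
    {C₀ C₁ M₀ : ℝ} (hC₀ : 0 ≤ C₀) (hC₁ : 0 ≤ C₁) (hM₀ : 0 < M₀) (Ks : ℕ → X → X → E)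
    (hK0 : ∀ u v, ‖Ks 0 u v‖ ≤ C₀ * (P₀ u v * Real.exp (-(c * d u v))))
    (hKS : ∀ j u v, ‖Ks (j + 1) u v‖ ≤ C₁ / M₀ * (P u v * Real.exp (-(c * d u v)))) (n : ℕ) (x y : X) :
    ‖pathKernel w Ks n x y‖ ≤ C₀ * Real.exp (3 * c * r) * (C₁ * θ * K * Real.exp (2 * c * r) / M₀) ^ n
        * P₀ x y * Real.exp (-(c / 2) * d x y) := by
  have hF0 : ∀ u v, 0 ≤ P u v * Real.exp (-(c * d u v)) := fun u v => mul_nonneg (hP0 u v) (Real.exp_pos _).le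
  have h1 := norm_pathKernel_le₂ hw hF0 (by positivity : 0 ≤ C₁ / M₀) Ks hK0 hKS n x y
  rw [fullNest₂_eq_sum_blockNest₂ blk] at h1
  have hblk : ∀ b, ∀ u ∈ univ.filter (fun u => blk u = b), blk u = b :=
    fun b u hu => (mem_filter.1 hu).2
  have h2 := sum_blockNest₂_le (Δ := fun b => univ.filter fun u => blk u = b) hw hθ hc hP0 hP₀0 hconv hconv₀
    hd0 hsymm htri hrad hblk hK n x y
  refine h1.trans ?_
  calc C₀ * (C₁ / M₀) ^ n *
        ∑ bs : Fin n → B, blockNest₂ (fun b => univ.filter fun u => blk u = b) w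
          (fun u v => P₀ u v * Real.exp (-(c * d u v))) (fun u v => P u v * Real.exp (-(c * d u v))) n x bs y
      ≤ C₀ * (C₁ / M₀) ^ n * (Real.exp (3 * c * r) * (θ * K * Real.exp (2 * c * r)) ^ n * P₀ x y *
          Real.exp (-(c / 2) * d x y)) := mul_le_mul_of_nonneg_left h2 (by positivity)
    _ = _ := by
        have e : (C₁ * θ * K * Real.exp (2 * c * r) / M₀) ^ n
            = (C₁ / M₀) ^ n * (θ * K * Real.exp (2 * c * r)) ^ n := by
          rw [← mul_pow]; congr 1; ring
        rw [e]; ring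

end TwoProfileWalk

/-! ## §6 (v1.1) (202)–(203) on the `ℤ³` lattice: discharged by LEMMA 1 (130)–(131) -/

section Z3Boson

/-- **(202) «by (129), (130), (131)» — the `ℤ³` lattice member DISCHARGED for the boson profile
`P = d′^{−1} + d′^{−2}`**: for a block `U` of at most `R³` sites at spacing `η`,
`Σ_{y∈U} η³·P(u,y)P(y,v) ≤ θ′·P(u,v)` with `θ′ = 4C(1)(ηR)² + 2√8C(2)(ηR) + 8C(2)(ηR)` (the four cross terms by (130) at
`α = 1`, (131) twice, (130) at `α = 2`). [cite: Dimock2004QED3TorusII, §3.3 proof of Thm 2 (202) p.30 L75–89 and §3.1 Lemma 1 (130)–(131) p.21 L40–45] -/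
theorem hconv_Z3_boson {η : ℝ} (hη : 0 < η) {R : ℕ} (hR : 1 ≤ R) (U : Finset (Fin 3 → ℤ))
    (hcard : U.card ≤ R ^ 3) (u v : Fin 3 → ℤ) :
    ∑ y ∈ U, η ^ 3 *
        ((dprime η u y ^ (-(1 : ℝ)) + dprime η u y ^ (-(2 : ℝ))) *
          (dprime η y v ^ (-(1 : ℝ)) + dprime η y v ^ (-(2 : ℝ))))
      ≤ (2 ^ ((1 : ℝ) + 1) * blockConst 1 * (η * R) ^ ((3 : ℝ) - 1)
          + 2 * (Real.sqrt 8 * blockConst 2 * (η * R))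
          + 2 ^ ((2 : ℝ) + 1) * blockConst 2 * (η * R) ^ ((3 : ℝ) - 2))
        * (dprime η u v ^ (-(1 : ℝ)) + dprime η u v ^ (-(2 : ℝ))) := by
  -- the four terms
  have h11 := eq130 (α := 1) (by norm_num) (by norm_num) hη U hR hcard u v
  have h22 := eq130 (α := 2) (by norm_num) (by norm_num) hη U hR hcard u v
  have h12 := eq131 hη U hR hcard u v
  have h21 := eq131 hη U hR hcard v u
  unfold blockIntegral at h11 h22 h12 h21
  beta_reduce at h11 h22 h12 h21
  -- rewrite the (2,1) term by symmetry of d′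
  have h21' : ∑ y ∈ U, η ^ 3 * (dprime η u y ^ (-(2 : ℝ)) * dprime η y v ^ (-(1 : ℝ)))
      ≤ Real.sqrt 8 * blockConst 2 * (η * R) * dprime η u v ^ (-(1 : ℝ)) := by
    have e : ∀ y, dprime η u y ^ (-(2 : ℝ)) * dprime η y v ^ (-(1 : ℝ))
        = dprime η v y ^ (-(1 : ℝ)) * dprime η y u ^ (-(2 : ℝ)) := by
      intro y; rw [dprime_comm η u y, dprime_comm η y v, mul_comm]
    simp_rw [e]
    rw [dprime_comm η u v]
    exact h21
  -- nonnegativity of the pieces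
  have hd1 : 0 ≤ dprime η u v ^ (-(1 : ℝ)) := Real.rpow_nonneg (dprime_pos hη u v).le _
  have hd2 : 0 ≤ dprime η u v ^ (-(2 : ℝ)) := Real.rpow_nonneg (dprime_pos hη u v).le _
  have hηR : 0 ≤ η * R := by positivity
  have hC1 : 0 ≤ blockConst 1 := zero_le_one.trans (one_le_blockConst (by norm_num))
  have hC2 : 0 ≤ blockConst 2 := zero_le_one.trans (one_le_blockConst (by norm_num))
  have hc11 : 0 ≤ 2 ^ ((1 : ℝ) + 1) * blockConst 1 * (η * R) ^ ((3 : ℝ) - 1) := by positivity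
  have hc12 : 0 ≤ Real.sqrt 8 * blockConst 2 * (η * R) := by positivity
  have hc22 : 0 ≤ 2 ^ ((2 : ℝ) + 1) * blockConst 2 * (η * R) ^ ((3 : ℝ) - 2) := by positivity
  -- expand the product
  have hexp : ∀ y, η ^ 3 * ((dprime η u y ^ (-(1 : ℝ)) + dprime η u y ^ (-(2 : ℝ))) *
      (dprime η y v ^ (-(1 : ℝ)) + dprime η y v ^ (-(2 : ℝ))))
      = η ^ 3 * (dprime η u y ^ (-(1 : ℝ)) * dprime η y v ^ (-(1 : ℝ)))
        + η ^ 3 * (dprime η u y ^ (-(1 : ℝ)) * dprime η y v ^ (-(2 : ℝ)))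
        + η ^ 3 * (dprime η u y ^ (-(2 : ℝ)) * dprime η y v ^ (-(1 : ℝ)))
        + η ^ 3 * (dprime η u y ^ (-(2 : ℝ)) * dprime η y v ^ (-(2 : ℝ))) := by
    intro y; ring
  simp_rw [hexp]
  rw [sum_add_distrib, sum_add_distrib, sum_add_distrib]
  set c11 := 2 ^ ((1 : ℝ) + 1) * blockConst 1 * (η * R) ^ ((3 : ℝ) - 1)
  set c12 := Real.sqrt 8 * blockConst 2 * (η * R)
  set c22 := 2 ^ ((2 : ℝ) + 1) * blockConst 2 * (η * R) ^ ((3 : ℝ) - 2)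
  set D1 := dprime η u v ^ (-(1 : ℝ))
  set D2 := dprime η u v ^ (-(2 : ℝ))
  calc _ ≤ c11 * D1 + c12 * D1 + c12 * D1 + c22 * D2 :=
        add_le_add (add_le_add (add_le_add h11 h12) h21') h22
    _ ≤ (c11 + 2 * c12 + c22) * (D1 + D2) := by nlinarith
    _ = _ := by ring

/-- **(203) — the last step of the boson chain on `ℤ³` DISCHARGED**: `Σ_{y∈U} η³·d′(u,y)^{−1}·P(y,v) ≤ θ′·d′(u,v)^{−1}`
with the same `θ′` as in `hconv_Z3_boson` ((130) at `α = 1` and (131); the surplus terms of `θ′` are `≥ 0`).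
[cite: Dimock2004QED3TorusII, §3.3 proof of Thm 2 (203) p.31 L1–5 and §3.1 Lemma 1 (130)–(131) p.21 L40–45] -/
theorem hconv₀_Z3_boson {η : ℝ} (hη : 0 < η) {R : ℕ} (hR : 1 ≤ R) (U : Finset (Fin 3 → ℤ))
    (hcard : U.card ≤ R ^ 3) (u v : Fin 3 → ℤ) :
    ∑ y ∈ U, η ^ 3 *
        (dprime η u y ^ (-(1 : ℝ)) * (dprime η y v ^ (-(1 : ℝ)) + dprime η y v ^ (-(2 : ℝ))))
      ≤ (2 ^ ((1 : ℝ) + 1) * blockConst 1 * (η * R) ^ ((3 : ℝ) - 1)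
          + 2 * (Real.sqrt 8 * blockConst 2 * (η * R))
          + 2 ^ ((2 : ℝ) + 1) * blockConst 2 * (η * R) ^ ((3 : ℝ) - 2))
        * dprime η u v ^ (-(1 : ℝ)) := by
  have h11 := eq130 (α := 1) (by norm_num) (by norm_num) hη U hR hcard u v
  have h12 := eq131 hη U hR hcard u v
  unfold blockIntegral at h11 h12
  beta_reduce at h11 h12
  have hd1 : 0 ≤ dprime η u v ^ (-(1 : ℝ)) := Real.rpow_nonneg (dprime_pos hη u v).le _
  have hηR : 0 ≤ η * R := by positivity
  have hC2 : 0 ≤ blockConst 2 := zero_le_one.trans (one_le_blockConst (by norm_num))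
  have hc12 : 0 ≤ Real.sqrt 8 * blockConst 2 * (η * R) := by positivity
  have hc22 : 0 ≤ 2 ^ ((2 : ℝ) + 1) * blockConst 2 * (η * R) ^ ((3 : ℝ) - 2) := by positivity
  have hexp : ∀ y, η ^ 3 * (dprime η u y ^ (-(1 : ℝ)) * (dprime η y v ^ (-(1 : ℝ)) + dprime η y v ^ (-(2 : ℝ))))
      = η ^ 3 * (dprime η u y ^ (-(1 : ℝ)) * dprime η y v ^ (-(1 : ℝ)))
        + η ^ 3 * (dprime η u y ^ (-(1 : ℝ)) * dprime η y v ^ (-(2 : ℝ))) := by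
    intro y; ring
  simp_rw [hexp]
  rw [sum_add_distrib]
  set c11 := 2 ^ ((1 : ℝ) + 1) * blockConst 1 * (η * R) ^ ((3 : ℝ) - 1)
  set c12 := Real.sqrt 8 * blockConst 2 * (η * R)
  set c22 := 2 ^ ((2 : ℝ) + 1) * blockConst 2 * (η * R) ^ ((3 : ℝ) - 2)
  set D1 := dprime η u v ^ (-(1 : ℝ))
  calc _ ≤ c11 * D1 + c12 * D1 := add_le_add h11 h12
    _ ≤ (c11 + 2 * c12 + c22) * D1 := by nlinarith
    _ = _ := by ring

end Z3Boson

/-! ## §7 (v1.2) (132): counting the paths — «adjacent cubes … touch, possibly only on corners» -/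

section WalkCount

variable {C : Type*} [Fintype C] [DecidableEq C] (adj : C → C → Prop) [DecidableRel adj] (S₀ : Finset C)

/-- **The paths `ω = (□_0, …, □_n)` of (132)** with `n` links: `□_0` in the start set `S₀` (the cubes `□` with `x ∈ □̃`)
and consecutive cubes adjacent (*"`□_j, □_{j+1}` should touch, possibly only on corners, and including the possibility
`□_j = □_{j+1}`"*). [cite: Dimock2004QED3TorusII, §3.2 (132) p.22 L2–11] -/
def walks (n : ℕ) : Finset (Fin (n + 1) → C) :=
  univ.filter fun ω => ω 0 ∈ S₀ ∧ ∀ j : Fin n, adj (ω j.castSucc) (ω j.succ)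

variable {adj S₀}

/-- membership in `walks`. [cite: Dimock2004QED3TorusII, §3.2 (132) p.22 L2–11] -/
theorem mem_walks {n : ℕ} {ω : Fin (n + 1) → C} :
    ω ∈ walks adj S₀ n ↔ ω 0 ∈ S₀ ∧ ∀ j : Fin n, adj (ω j.castSucc) (ω j.succ) := by
  simp [walks]

/-- **The number of paths with `n` links is at most `ν^{n+1}`** when the start set has `≤ ν` cubes and every cube is
adjacent to `≤ ν` cubes (`ν = 3³ = 27` for the cubes of `D` touching a given one, itself included) — the count behind
*"The factor `(O(1)M₀)^{−n}` is sufficient to control the sum if `M₀` is sufficiently large"*.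
[cite: Dimock2004QED3TorusII, §3.2 (132) p.22 L2–11 and proof of Thm 1 p.25 L10–12] -/
theorem card_walks_le {ν : ℕ} (hS : S₀.card ≤ ν) (hadj : ∀ c, (univ.filter fun c' => adj c c').card ≤ ν) :
    ∀ n, (walks adj S₀ n).card ≤ ν ^ (n + 1)
  | 0 => by
      refine le_trans ?_ (le_of_le_of_eq hS (by simp))
      refine Finset.card_le_card_of_injOn (fun ω => ω 0) (fun ω hω => (mem_walks.1 (mem_coe.1 hω)).1) ?_
      intro ω _ ω' _ h
      funext j
      have hj : j = 0 := Fin.eq_zero j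
      rw [hj]
      exact h
  | n + 1 => by
      have ih := card_walks_le hS hadj n
      -- ω ↦ (its first n+1 cubes, its last cube)
      have hmaps : ∀ ω ∈ walks adj S₀ (n + 1),
          (⟨Fin.init ω, ω (Fin.last (n + 1))⟩ : Σ _ : Fin (n + 1) → C, C)
            ∈ (walks adj S₀ n).sigma fun ω' => univ.filter fun c' => adj (ω' (Fin.last n)) c' := by
        intro ω hω
        rcases mem_walks.1 hω with ⟨h0, hadjω⟩
        rw [Finset.mem_sigma]
        refine ⟨mem_walks.2 ⟨?_, fun j => ?_⟩, ?_⟩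
        · show ω (Fin.castSucc 0) ∈ S₀
          rw [Fin.castSucc_zero]; exact h0
        · show adj (ω j.castSucc.castSucc) (ω j.succ.castSucc)
          rw [← Fin.succ_castSucc]; exact hadjω j.castSucc
        · rw [Finset.mem_filter]
          refine ⟨mem_univ _, ?_⟩
          show adj (ω (Fin.last n).castSucc) (ω (Fin.last (n + 1)))
          rw [← Fin.succ_last]; exact hadjω (Fin.last n)
      have hinj : Set.InjOn (fun ω : Fin (n + 2) → C => (⟨Fin.init ω, ω (Fin.last (n + 1))⟩ : Σ _ : Fin (n + 1) → C, C))
          (walks adj S₀ (n + 1) : Set (Fin (n + 2) → C)) := by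
        intro ω _ ω' _ h
        simp only [Sigma.mk.injEq, heq_eq_eq] at h
        rw [← Fin.snoc_init_self ω, ← Fin.snoc_init_self ω', h.1, h.2]
      calc (walks adj S₀ (n + 1)).card
          ≤ ((walks adj S₀ n).sigma fun ω' => univ.filter fun c' => adj (ω' (Fin.last n)) c').card :=
            Finset.card_le_card_of_injOn _ hmaps hinj
        _ = ∑ ω' ∈ walks adj S₀ n, (univ.filter fun c' => adj (ω' (Fin.last n)) c').card := Finset.card_sigma _ _
        _ ≤ ∑ _ω' ∈ walks adj S₀ n, ν := sum_le_sum fun ω' _ => hadj _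
        _ = (walks adj S₀ n).card * ν := by rw [sum_const, smul_eq_mul]
        _ ≤ ν ^ (n + 1) * ν := Nat.mul_le_mul_right _ ih
        _ = ν ^ (n + 1 + 1) := by ring

/-- **THEOREM 1 (135) with the path count made geometric.**  With the paths of (132) (`walks adj S₀ n`, start set of
`≤ ν` cubes, every cube adjacent to `≤ ν` cubes) and each path term bounded as in (134) by `C₀(C₂∕M₀)^nΦ`, for
`M₀ ≥ 2νC₂` every partial sum of the random walk expansion obeys `‖Σ_{n<N}Σ_{ω}S_n(ω)‖ ≤ 2νC₀Φ`.
[cite: Dimock2004QED3TorusII, §3.2 Thm 1 (135) p.22 L12–21, (132) p.22 L2–11, proof p.25 L10–12] -/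
theorem dimock135_walks {E : Type*} [SeminormedAddCommGroup E] (S : (n : ℕ) → (Fin (n + 1) → C) → E)
    {ν : ℕ} (hS₀ : S₀.card ≤ ν) (hadj : ∀ c, (univ.filter fun c' => adj c c').card ≤ ν)
    {C₀ C₂ M₀ Φ : ℝ} (hC₀ : 0 ≤ C₀) (hC₂ : 0 ≤ C₂) (hΦ : 0 ≤ Φ) (hM₀ : 0 < M₀)
    (hlarge : 2 * ((ν : ℝ) * C₂) ≤ M₀)
    (hS : ∀ n, ∀ ω ∈ walks adj S₀ n, ‖S n ω‖ ≤ C₀ * (C₂ / M₀) ^ n * Φ) (N : ℕ) :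
    ‖∑ n ∈ range N, ∑ ω ∈ walks adj S₀ n, S n ω‖ ≤ 2 * ν * C₀ * Φ := by
  have hν : (0 : ℝ) ≤ ν := Nat.cast_nonneg ν
  have hq0 : 0 ≤ (ν : ℝ) * C₂ / M₀ := by positivity
  have hq : (ν : ℝ) * C₂ / M₀ ≤ 1 / 2 := by
    rw [div_le_iff₀ hM₀]; linarith
  have hcard : ∀ n, ((walks adj S₀ n).card : ℝ) ≤ (ν : ℝ) ^ (n + 1) := fun n => by
    exact_mod_cast card_walks_le hS₀ hadj n
  calc ‖∑ n ∈ range N, ∑ ω ∈ walks adj S₀ n, S n ω‖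
      ≤ ∑ n ∈ range N, ‖∑ ω ∈ walks adj S₀ n, S n ω‖ := norm_sum_le _ _
    _ ≤ ∑ n ∈ range N, ∑ ω ∈ walks adj S₀ n, ‖S n ω‖ := sum_le_sum fun n _ => norm_sum_le _ _
    _ ≤ ∑ n ∈ range N, ∑ ω ∈ walks adj S₀ n, C₀ * (C₂ / M₀) ^ n * Φ :=
        sum_le_sum fun n _ => sum_le_sum fun ω hω => hS n ω hω
    _ = ∑ n ∈ range N, ((walks adj S₀ n).card : ℝ) * (C₀ * (C₂ / M₀) ^ n * Φ) := by
        refine sum_congr rfl fun n _ => ?_; rw [sum_const, nsmul_eq_mul]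
    _ ≤ ∑ n ∈ range N, (ν : ℝ) ^ (n + 1) * (C₀ * (C₂ / M₀) ^ n * Φ) :=
        sum_le_sum fun n _ => mul_le_mul_of_nonneg_right (hcard n) (by positivity)
    _ = ν * C₀ * Φ * ∑ n ∈ range N, ((ν : ℝ) * C₂ / M₀) ^ n := by
        rw [mul_sum]; refine sum_congr rfl fun n _ => ?_
        rw [pow_succ, mul_div_assoc, mul_pow]; ring
    _ ≤ ν * C₀ * Φ * ∑ n ∈ range N, (1 / 2 : ℝ) ^ n := by
        refine mul_le_mul_of_nonneg_left (sum_le_sum fun n _ => ?_) (by positivity)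
        exact pow_le_pow_left₀ hq0 hq n
    _ ≤ ν * C₀ * Φ * 2 := mul_le_mul_of_nonneg_left (sum_geometric_two_le N) (by positivity)
    _ = 2 * ν * C₀ * Φ := by ring

end WalkCount

end QED3TorusII

end Literature.MathematicalPhysics.QuantumFieldTheory.Dimock2011to13
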